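import Summits.AtomisticToContinuum.HydrodynamicLimit.Theses.AntiMazurCoboundaries
import Literature.MathematicalPhysics.KineticTheory.HardSphereEulerProofs
import Literature.MathematicalPhysics.KineticTheory.HardBallErgodicity

/-!
# Stub `stub_thermodynamicProfile` of line `almost-invariant-duality` — crux `AntiMazurCoboundaries.CorrectorPressureDecay`
(stmt-AtomisticToContinuum-14135)

Helper file (`--supports stmt-AtomisticToContinuum-14135`) proving the registered stub
`stub_thermodynamicProfile` of the lead's skeleton
`Cruxes/CorrectorPressureDecay/Lines/almost-invariant-duality.lean`: every bounded measurable
density `ρ` on the `(N + 1)`-sphere phase space has a bounded measurable *thermodynamic profile*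
`f (P, E)`, a version of `E_{G_N}[ρ | P, E]` (`P = configMomentum`, `E = configEnergy`,
`G_N` the constant-parameter local Gibbs law), pinned down by testing against bounded measurable
`B (P, E)`.

Proof summary (Radon–Nikodym of push-forwards, no conditional expectation).  On an abstract
finite measure space `(Ω, G)` with a measurable `S : Ω → T` and `0 ≤ ρ ≤ C` measurable
(`profile_aux`): the push-forward `ν := (ρ • G) ∘ S⁻¹` is dominated by `C • ν₀`,
`ν₀ := G ∘ S⁻¹`, hence `ν ≪ ν₀` and the Radon–Nikodym derivative `d := dν/dν₀` satisfies
`d ≤ C` `ν₀`-a.e.; the clipped profile `f₀ := min C d.toReal` is measurable, takes values in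
`[0, C]`, agrees with `d.toReal` a.e., and for every measurable `B̃ : T → ℝ` both
`∫ B̃ (S z) ρ z dG` and `∫ B̃ (S z) f₀ (S z) dG` equal `∫ B̃ dν` (change of variables
`integral_map` and `integral_withDensity_eq_integral_toReal_smul`, plus
`ν₀.withDensity d = ν`).  The stub is the instance `Ω` = phase space, `G = G_N` (a probability
measure for `σ ≤ 1/2`, tree theorem `isProbabilityMeasure_localGibbsLaw`),
`S z = (configMomentum z, configEnergy z)` (continuous, tree theorems
`continuous_configMomentum`, `continuous_configEnergy`), `f p e := f₀ (p, e)`.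
-/

noncomputable section

open MeasureTheory ProbabilityTheory Set Filter Topology
open scoped ENNReal

namespace Summit.AtomisticToContinuum.HydrodynamicLimit.Theorems.AlmostInvariantDuality

open Literature.MathematicalPhysics.KineticTheory (T3 V3 hsDiameter localGibbsLaw)
open Literature.Analysis.FluidPDE (HardSphereFlow Config configMomentum configEnergy)

/-- Abstract thermodynamic profile: for a finite measure `G`, a measurable `S : Ω → T` and a
measurable density `0 ≤ ρ ≤ C`, the clipped Radon–Nikodym derivative
`f₀ := min C (d((ρ • G) ∘ S⁻¹)/d(G ∘ S⁻¹)).toReal` is a bounded measurable version of `E_G[ρ | S]`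
as a function on `T`: `∫ B̃ (S z) ρ z dG = ∫ B̃ (S z) f₀ (S z) dG` for every measurable `B̃`. -/
private theorem profile_aux {Ω T : Type*} [MeasurableSpace Ω] [MeasurableSpace T] (G : Measure Ω)
    [IsFiniteMeasure G] {S : Ω → T} (hS : Measurable S) {ρ : Ω → ℝ} (hρm : Measurable ρ)
    (hρ0 : ∀ z, 0 ≤ ρ z) {C : ℝ} (hρC : ∀ z, ρ z ≤ C) (hC : 0 ≤ C) :
    ∃ f₀ : T → ℝ, Measurable f₀ ∧ (∀ q, 0 ≤ f₀ q) ∧ (∀ q, f₀ q ≤ C) ∧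
      ∀ Bt : T → ℝ, Measurable Bt →
        ∫ z, Bt (S z) * ρ z ∂G = ∫ z, Bt (S z) * f₀ (S z) ∂G := by
  -- domination of the weighted push-forward `ν` by `C • ν₀`
  have hle : ((G.withDensity fun z => ENNReal.ofReal (ρ z)).map S) ≤
      ENNReal.ofReal C • G.map S := by
    refine Measure.le_iff.2 fun s hs => ?_
    rw [Measure.smul_apply, smul_eq_mul, Measure.map_apply hS hs, Measure.map_apply hS hs,
      withDensity_apply _ (hS hs)]
    calc ∫⁻ z in S ⁻¹' s, ENNReal.ofReal (ρ z) ∂G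
        ≤ ∫⁻ z in S ⁻¹' s, ENNReal.ofReal C ∂G :=
          lintegral_mono fun z => ENNReal.ofReal_le_ofReal (hρC z)
      _ = ENNReal.ofReal C * G (S ⁻¹' s) := setLIntegral_const _ _
  haveI hfin : IsFiniteMeasure ((G.withDensity fun z => ENNReal.ofReal (ρ z)).map S) := by
    refine ⟨(hle Set.univ).trans_lt ?_⟩
    rw [Measure.smul_apply, smul_eq_mul]
    exact ENNReal.mul_lt_top ENNReal.ofReal_lt_top (measure_lt_top _ _)
  have hac : ((G.withDensity fun z => ENNReal.ofReal (ρ z)).map S) ≪ G.map S :=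
    Measure.absolutelyContinuous_of_le_smul hle
  -- the Radon–Nikodym derivative `d` and its a.e. bound
  have hd_meas : Measurable
      (((G.withDensity fun z => ENNReal.ofReal (ρ z)).map S).rnDeriv (G.map S)) :=
    Measure.measurable_rnDeriv _ _
  have hd_le : ((G.withDensity fun z => ENNReal.ofReal (ρ z)).map S).rnDeriv (G.map S)
      ≤ᵐ[G.map S] fun _ => ENNReal.ofReal C := by
    refine ae_le_of_forall_setLIntegral_le_of_sigmaFinite hd_meas fun s _ _ => ?_
    rw [setLIntegral_const]
    calc ∫⁻ x in s, ((G.withDensity fun z => ENNReal.ofReal (ρ z)).map S).rnDeriv (G.map S) x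
          ∂(G.map S)
        ≤ ((G.withDensity fun z => ENNReal.ofReal (ρ z)).map S) s :=
          Measure.setLIntegral_rnDeriv_le s
      _ ≤ (ENNReal.ofReal C • G.map S) s := hle s
      _ = ENNReal.ofReal C * G.map S s := by rw [Measure.smul_apply, smul_eq_mul]
  have hd_lt_top : ∀ᵐ x ∂(G.map S),
      ((G.withDensity fun z => ENNReal.ofReal (ρ z)).map S).rnDeriv (G.map S) x < ∞ :=
    hd_le.mono fun x hx => hx.trans_lt ENNReal.ofReal_lt_top
  have hd_toReal : ∀ᵐ x ∂(G.map S),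
      min C (((G.withDensity fun z => ENNReal.ofReal (ρ z)).map S).rnDeriv (G.map S) x).toReal =
        (((G.withDensity fun z => ENNReal.ofReal (ρ z)).map S).rnDeriv (G.map S) x).toReal :=
    hd_le.mono fun x hx => min_eq_right (ENNReal.toReal_le_of_le_ofReal hC hx)
  refine ⟨fun q => min C (((G.withDensity fun z => ENNReal.ofReal (ρ z)).map S).rnDeriv
      (G.map S) q).toReal, measurable_const.min hd_meas.ennreal_toReal,
    fun q => le_min hC ENNReal.toReal_nonneg, fun q => min_le_left _ _, fun Bt hBt => ?_⟩
  -- both sides equal `∫ B̃ dν`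
  have h1 : ∫ z, Bt (S z) * ρ z ∂G =
      ∫ q, Bt q ∂((G.withDensity fun z => ENNReal.ofReal (ρ z)).map S) := by
    rw [integral_map hS.aemeasurable hBt.aestronglyMeasurable,
      integral_withDensity_eq_integral_toReal_smul hρm.ennreal_ofReal
        (Eventually.of_forall fun _ => ENNReal.ofReal_lt_top)]
    refine integral_congr_ae (Eventually.of_forall fun z => ?_)
    simp only
    rw [ENNReal.toReal_ofReal (hρ0 z), smul_eq_mul, mul_comm]
  have h2 : ∫ z, Bt (S z) * min C (((G.withDensity fun z => ENNReal.ofReal (ρ z)).map S).rnDeriv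
        (G.map S) (S z)).toReal ∂G =
      ∫ q, Bt q ∂((G.withDensity fun z => ENNReal.ofReal (ρ z)).map S) := by
    have hm : AEStronglyMeasurable (fun q => Bt q * min C
        (((G.withDensity fun z => ENNReal.ofReal (ρ z)).map S).rnDeriv (G.map S) q).toReal)
        (G.map S) :=
      (hBt.mul (measurable_const.min hd_meas.ennreal_toReal)).aestronglyMeasurable
    rw [← integral_map hS.aemeasurable hm]
    calc ∫ q, Bt q * min C
            (((G.withDensity fun z => ENNReal.ofReal (ρ z)).map S).rnDeriv (G.map S) q).toReal
            ∂(G.map S)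
        = ∫ q, (((G.withDensity fun z => ENNReal.ofReal (ρ z)).map S).rnDeriv (G.map S) q).toReal
            • Bt q ∂(G.map S) :=
          integral_congr_ae (hd_toReal.mono fun q hq => by
            simp only
            rw [hq, smul_eq_mul, mul_comm])
      _ = ∫ q, Bt q ∂((G.map S).withDensity
            (((G.withDensity fun z => ENNReal.ofReal (ρ z)).map S).rnDeriv (G.map S))) :=
          (integral_withDensity_eq_integral_toReal_smul hd_meas hd_lt_top Bt).symm
      _ = ∫ q, Bt q ∂((G.withDensity fun z => ENNReal.ofReal (ρ z)).map S) := by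
          rw [Measure.withDensity_rnDeriv_eq _ _ hac]
  exact h1.trans h2.symm

/-- STUB 3a of line `almost-invariant-duality` (**thermodynamic profile**): every bounded
measurable probability density `ρ` with respect to the constant-parameter local Gibbs law `G_N`
has a bounded measurable profile `f (P, E)` — a version of `E_{G_N}[ρ | P, E]`,
`P = configMomentum`, `E = configEnergy` — characterised by testing against bounded measurable
`B (P, E)`.  Radon–Nikodym of push-forwards plus clipping (`profile_aux`). -/
theorem stub_thermodynamicProfile :
    ∀ (σ a θ : ℝ) (u₀ : V3), 0 < σ → σ ≤ 1 / 2 → 0 < a → 0 < θ → ∀ (N : ℕ)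
      (Φ : HardSphereFlow (Literature.Analysis.FluidPDE.Torus.geometry (Fin 3)) (hsDiameter σ N) (N + 1)),
      ∀ ρ : Config (N + 1) (Fin 3) T3 → ℝ, Measurable ρ → (∀ z, 0 ≤ ρ z) → (∃ C : ℝ, ∀ z, ρ z ≤ C) →
        ∫ z, ρ z ∂(localGibbsLaw σ (fun _ => a) (fun _ => u₀) (fun _ => θ) N Φ) = 1 →
        ∃ f : V3 → ℝ → ℝ, Measurable (fun p : V3 × ℝ => f p.1 p.2) ∧ (∀ p e, 0 ≤ f p e) ∧
          (∃ C : ℝ, ∀ p e, f p e ≤ C) ∧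
          ∀ B : V3 → ℝ → ℝ, Measurable (fun p : V3 × ℝ => B p.1 p.2) → (∃ C : ℝ, ∀ p e, |B p e| ≤ C) →
            ∫ z, B (configMomentum z) (configEnergy z) * ρ z ∂(localGibbsLaw σ (fun _ => a) (fun _ => u₀) (fun _ => θ) N Φ) =
              ∫ z, B (configMomentum z) (configEnergy z) *
                f (configMomentum z) (configEnergy z) ∂(localGibbsLaw σ (fun _ => a) (fun _ => u₀) (fun _ => θ) N Φ) := by
  intro σ a θ u₀ _hσ hσ2 ha hθ N Φ ρ hρm hρ0 hρC _hρ1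
  obtain ⟨C, hC⟩ := hρC
  haveI : IsProbabilityMeasure (localGibbsLaw σ (fun _ => a) (fun _ => u₀) (fun _ => θ) N Φ) :=
    Literature.MathematicalPhysics.KineticTheory.isProbabilityMeasure_localGibbsLaw
      continuous_const continuous_const continuous_const (fun _ => ha) (fun _ => hθ) hσ2 N Φ
  have hS : Measurable fun z : Config (N + 1) (Fin 3) T3 => (configMomentum z, configEnergy z) :=
    Literature.MathematicalPhysics.KineticTheory.continuous_configMomentum.measurable.prodMk
      Literature.MathematicalPhysics.KineticTheory.continuous_configEnergy.measurable
  obtain ⟨f₀, hf₀m, hf₀0, hf₀C, hf₀⟩ :=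
    profile_aux (localGibbsLaw σ (fun _ => a) (fun _ => u₀) (fun _ => θ) N Φ) hS hρm hρ0
      (C := max C 0) (fun z => (hC z).trans (le_max_left _ _)) (le_max_right _ _)
  refine ⟨fun p e => f₀ (p, e), hf₀m.comp (measurable_fst.prodMk measurable_snd),
    fun p e => hf₀0 _, ⟨max C 0, fun p e => hf₀C _⟩, fun B hB _ => ?_⟩
  exact hf₀ (fun q => B q.1 q.2) hB

end Summit.AtomisticToContinuum.HydrodynamicLimit.Theorems.AlmostInvariantDuality

end
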